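import Mathlib
import Summits.RiemannHypothesis.RiemannHypothesis.Theorems.SoloInformedHighPart
import HarnessLib

/-!
# The half-lag bound for autocorrelations and the tapered prime term (handoff prove-1, ATTEMPT-16 §R.4, LEMMA BK½)

For a test `G` supported in `[-b, b]` the autocorrelation `K = G ⋆ G̃` satisfies `‖K(y)‖ ≤ ‖G‖₂²`
for every lag (the tree's `norm_weilConv_weilReflect_le`, Bombieri's Lemma 2) and
**`‖K(y)‖ ≤ ‖G‖₂² / 2` for `|y| > b`** (the two factors of `G(u) conj G(u-y)` then
live on disjoint halves of the window; AM–GM).  Consequently the prime term of `K` (support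
`[-2b, 2b]`) obeys the TAPERED bound
`‖prime(G ⋆ G̃)‖ ≤ (S(2b) + S(b)) ‖G‖₂²`, `S(x) = Σ_{n ≤ e^x} Λ(n)/√n` (`primeSum`),
instead of `2 S(2b) ‖G‖₂²` (`norm_weilPrimeTerm_le_of_tsupport_subset` with `‖K‖ ≤ ‖G‖₂²`): the
prime powers in `(e^b, e^{2b}]` count with half weight.  This is the elementary case of the
prime-shift bound `prime(G ⋆ G̃) ≤ Λ_P(b) ‖G‖₂²` (LEMMA P of ATTEMPT-16 §R.3; `Λ_P ≤ S(2b) + S(b)`),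
which lowers the infrared height of THEOREM V's high part from `exp(2S)` to `exp(Λ_P)`.
Nothing here bears on the truth of RH; no hypothesis on the zeros of `ζ` is used.
-/

set_option linter.dupNamespace false

open scoped Real ComplexConjugate ArithmeticFunction.vonMangoldt
open Complex MeasureTheory Set Filter Literature.NumberTheory.LFunctions

namespace Summit.RiemannHypothesis.RiemannHypothesis.Theorems

variable {G : ℝ → ℂ} {b : ℝ}

/-- `(G ⋆ G̃)(y) = ∫ G(u) conj G(u - y) du`. -/
theorem autoCorr_apply (G : ℝ → ℂ) (y : ℝ) :
    autoCorr G y = ∫ u : ℝ, G u * conj (G (u - y)) := by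
  rw [autoCorr, weilConv_apply]
  congr 1 with u
  simp [weilReflect, neg_sub]

/-- **Half-lag bound, positive lags:** for `supp G ⊆ [-b, b]` and `y > b`,
`‖(G ⋆ G̃)(y)‖ ≤ ‖G‖₂² / 2`. -/
theorem norm_autoCorr_le_half_of_lt (hG : IsWeilTest G) (hsupp : tsupport G ⊆ Icc (-b) b)
    {y : ℝ} (hy : b < y) : ‖autoCorr G y‖ ≤ weilNorm2Sq G / 2 := by
  rw [autoCorr_apply, weilNorm2Sq]
  have hzero : ∀ x, G x ≠ 0 → x ∈ Icc (-b) b := fun x hx ↦ hsupp (subset_tsupport _ hx)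
  set f : ℝ → ℝ := fun u ↦ ‖G u‖ ^ 2 with hf
  have hi : Integrable f := hG.integrable_norm_sq
  set p₁ : ℝ → ℝ := (Ioi (0 : ℝ)).indicator f with hp₁
  set p₂ : ℝ → ℝ := fun u ↦ (Iio (0 : ℝ)).indicator f (u - y) with hp₂
  have hp₁i : Integrable p₁ := hi.indicator measurableSet_Ioi
  have hp₂i : Integrable p₂ := (hi.indicator measurableSet_Iio).comp_sub_right y
  -- pointwise AM–GM with the support information
  have hpt : ∀ u : ℝ, ‖G u * conj (G (u - y))‖ ≤ (p₁ u + p₂ u) / 2 := by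
    intro u
    have hp₁0 : 0 ≤ p₁ u := Set.indicator_nonneg (fun _ _ ↦ sq_nonneg _) _
    have hp₂0 : 0 ≤ p₂ u := Set.indicator_nonneg (fun _ _ ↦ sq_nonneg _) _
    by_cases h1 : G u = 0
    · simp [h1]; positivity
    by_cases h2 : G (u - y) = 0
    · simp [h2]; positivity
    have hu := hzero u h1
    have huy := hzero (u - y) h2
    simp only [mem_Icc] at hu huy
    have hu0 : u ∈ Ioi (0 : ℝ) := by simp only [mem_Ioi]; linarith
    have huy0 : u - y ∈ Iio (0 : ℝ) := by simp only [mem_Iio]; linarith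
    have e1 : p₁ u = ‖G u‖ ^ 2 := by rw [hp₁, Set.indicator_of_mem hu0]
    have e2 : p₂ u = ‖G (u - y)‖ ^ 2 := by simp only [hp₂]; rw [Set.indicator_of_mem huy0]
    rw [e1, e2, norm_mul, Complex.norm_conj]
    nlinarith [sq_nonneg (‖G u‖ - ‖G (u - y)‖)]
  have hI1 : ∫ u, p₁ u = ∫ u in Ioi (0 : ℝ), f u := integral_indicator measurableSet_Ioi
  have hI2 : ∫ u, p₂ u = ∫ u in Iio (0 : ℝ), f u := by
    rw [hp₂, integral_sub_right_eq_self (fun u : ℝ ↦ (Iio (0 : ℝ)).indicator f u) y]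
    exact integral_indicator measurableSet_Iio
  have hsplit : (∫ u in Ioi (0 : ℝ), f u) + ∫ u in Iio (0 : ℝ), f u ≤ ∫ u, f u := by
    have hdisj : Disjoint (Ioi (0 : ℝ)) (Iio 0) :=
      Set.disjoint_left.2 fun x hx hx' ↦ by simp only [mem_Ioi] at hx; simp only [mem_Iio] at hx'; linarith
    rw [← setIntegral_union hdisj measurableSet_Iio hi.integrableOn hi.integrableOn]
    exact setIntegral_le_integral hi (Eventually.of_forall fun _ ↦ sq_nonneg _)
  calc ‖∫ u : ℝ, G u * conj (G (u - y))‖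
      ≤ ∫ u : ℝ, ‖G u * conj (G (u - y))‖ := norm_integral_le_integral_norm _
    _ ≤ ∫ u : ℝ, (p₁ u + p₂ u) / 2 :=
        integral_mono_of_nonneg (Eventually.of_forall fun _ ↦ norm_nonneg _)
          ((hp₁i.add hp₂i).div_const 2) (Eventually.of_forall hpt)
    _ = ((∫ u, p₁ u) + ∫ u, p₂ u) / 2 := by rw [integral_div, integral_add hp₁i hp₂i]
    _ ≤ (∫ u, f u) / 2 := by rw [hI1, hI2]; linarith

/-- `(G ⋆ G̃)(-y) = conj (G ⋆ G̃)(y)` (from the tree's `conj_weilConv_weilReflect_neg`). -/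
theorem autoCorr_neg (G : ℝ → ℂ) (y : ℝ) : autoCorr G (-y) = conj (autoCorr G y) := by
  unfold autoCorr
  rw [← conj_weilConv_weilReflect_neg G y, Complex.conj_conj]

/-- **Half-lag bound:** for `supp G ⊆ [-b, b]` and `|y| > b`, `‖(G ⋆ G̃)(y)‖ ≤ ‖G‖₂² / 2`. -/
theorem norm_autoCorr_le_half (hG : IsWeilTest G) (hsupp : tsupport G ⊆ Icc (-b) b)
    {y : ℝ} (hy : b < |y|) : ‖autoCorr G y‖ ≤ weilNorm2Sq G / 2 := by
  rcases le_or_gt 0 y with h | h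
  · rw [abs_of_nonneg h] at hy
    exact norm_autoCorr_le_half_of_lt hG hsupp hy
  · rw [abs_of_neg h] at hy
    have := norm_autoCorr_le_half_of_lt hG hsupp hy
    rwa [show -y = -y from rfl, autoCorr_neg, Complex.norm_conj] at this

/-- **Two-level prime-term bound.** If `k` is continuous with `tsupport k ⊆ [-B, B]`,
`‖k‖ ≤ M₀` everywhere and `‖k(t)‖ ≤ M₁` for `|t| > c` (`c ≤ B`), then
`‖prime(k)‖ ≤ 2 M₀ S(c) + 2 M₁ (S(B) - S(c))`. -/
theorem norm_weilPrimeTerm_le_two_level {k : ℝ → ℂ} (hk : Continuous k) {B c M₀ M₁ : ℝ}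
    (hsupp : tsupport k ⊆ Icc (-B) B) (hcB : c ≤ B)
    (hM : ∀ t, ‖k t‖ ≤ M₀) (hMc : ∀ t, c < |t| → ‖k t‖ ≤ M₁) :
    ‖weilPrimeTerm k‖ ≤ 2 * M₀ * primeSum c + 2 * M₁ * (primeSum B - primeSum c) := by
  have hsup := support_subset_Ioo_of_tsupport_subset_Icc hk hsupp
  have hzero : ∀ x, x ∉ Ioo (-B) B → k x = 0 := fun x hx ↦
    Function.notMem_support.1 fun h ↦ hx (hsup h)
  set N := ⌊Real.exp B⌋₊ + 1 with hN
  set Nc := ⌊Real.exp c⌋₊ + 1 with hNc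
  set F : ℕ → ℂ := fun n ↦
    ((Λ n : ℝ) : ℂ) / (Real.sqrt n : ℂ) * (k (Real.log n) + k (-Real.log n)) with hF
  set w : ℕ → ℝ := fun n ↦ (Λ n : ℝ) / Real.sqrt n with hw
  have hw0 : ∀ n, 0 ≤ w n := fun n ↦
    div_nonneg ArithmeticFunction.vonMangoldt_nonneg (Real.sqrt_nonneg _)
  have hvan : ∀ n ∉ Finset.range N, F n = 0 := by
    intro n hn
    rw [Finset.mem_range, not_lt] at hn
    have hn1 : Real.exp B < n := (Nat.lt_floor_add_one _).trans_le (by exact_mod_cast hn)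
    have hpos : (0 : ℝ) < n := (Real.exp_pos B).trans hn1
    have hlog : B < Real.log n := (Real.lt_log_iff_exp_lt hpos).2 hn1
    have h1 : k (Real.log n) = 0 := hzero _ fun h ↦ absurd h.2 (not_lt.2 hlog.le)
    have h2 : k (-Real.log n) = 0 := hzero _ fun h ↦ by linarith [h.1]
    simp [hF, h1, h2]
  -- termwise bounds
  have hterm0 : ∀ n : ℕ, ‖F n‖ ≤ w n * (2 * M₀) := by
    intro n
    simp only [hF, hw]
    rw [norm_mul, norm_div, Complex.norm_real, Complex.norm_real,
      Real.norm_of_nonneg ArithmeticFunction.vonMangoldt_nonneg,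
      Real.norm_of_nonneg (Real.sqrt_nonneg _)]
    refine mul_le_mul_of_nonneg_left ?_ (hw0 n)
    exact (norm_add_le _ _).trans (by linarith [hM (Real.log n), hM (-Real.log n)])
  have hterm1 : ∀ n : ℕ, n ∉ Finset.range Nc → ‖F n‖ ≤ w n * (2 * M₁) := by
    intro n hn
    rw [Finset.mem_range, not_lt] at hn
    have hn1 : Real.exp c < n := (Nat.lt_floor_add_one _).trans_le (by exact_mod_cast hn)
    have hpos : (0 : ℝ) < n := (Real.exp_pos c).trans hn1
    have hlog : c < Real.log n := (Real.lt_log_iff_exp_lt hpos).2 hn1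
    have hlogabs : c < |Real.log n| := hlog.trans_le (le_abs_self _)
    have hlogabs' : c < |(-Real.log n)| := by rwa [abs_neg]
    simp only [hF, hw]
    rw [norm_mul, norm_div, Complex.norm_real, Complex.norm_real,
      Real.norm_of_nonneg ArithmeticFunction.vonMangoldt_nonneg,
      Real.norm_of_nonneg (Real.sqrt_nonneg _)]
    refine mul_le_mul_of_nonneg_left ?_ (hw0 n)
    exact (norm_add_le _ _).trans (by linarith [hMc _ hlogabs, hMc _ hlogabs'])
  have hNcN : Nc ≤ N := by
    simp only [hN, hNc]
    have := Nat.floor_mono (Real.exp_le_exp.2 hcB); omega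
  have hsum : weilPrimeTerm k = ∑ n ∈ Finset.range N, F n := tsum_eq_sum hvan
  have hM₀0 : 0 ≤ M₀ := (norm_nonneg _).trans (hM 0)
  rw [hsum]
  -- split the range at Nc
  have hsplit : ∑ n ∈ Finset.range N, ‖F n‖ =
      ∑ n ∈ Finset.range Nc, ‖F n‖ + ∑ n ∈ Finset.Ico Nc N, ‖F n‖ := by
    rw [Finset.range_eq_Ico, ← Finset.sum_Ico_consecutive _ (Nat.zero_le _) hNcN,
      ← Finset.range_eq_Ico]
  have hA : ∑ n ∈ Finset.range Nc, ‖F n‖ ≤ 2 * M₀ * primeSum c := by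
    calc ∑ n ∈ Finset.range Nc, ‖F n‖ ≤ ∑ n ∈ Finset.range Nc, w n * (2 * M₀) :=
          Finset.sum_le_sum fun n _ ↦ hterm0 n
      _ = 2 * M₀ * primeSum c := by rw [← Finset.sum_mul, primeSum, hNc]; ring
  have hB : ∑ n ∈ Finset.Ico Nc N, ‖F n‖ ≤ 2 * M₁ * (primeSum B - primeSum c) := by
    have hIco : ∀ n ∈ Finset.Ico Nc N, n ∉ Finset.range Nc := by
      intro n hn; rw [Finset.mem_Ico] at hn; rw [Finset.mem_range]; omega
    calc ∑ n ∈ Finset.Ico Nc N, ‖F n‖ ≤ ∑ n ∈ Finset.Ico Nc N, w n * (2 * M₁) :=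
          Finset.sum_le_sum fun n hn ↦ hterm1 n (hIco n hn)
      _ = 2 * M₁ * ∑ n ∈ Finset.Ico Nc N, w n := by rw [← Finset.sum_mul]; ring
      _ = 2 * M₁ * (primeSum B - primeSum c) := by
          congr 1
          rw [primeSum, primeSum, ← hN, ← hNc, Finset.range_eq_Ico, Finset.range_eq_Ico,
            ← Finset.sum_Ico_consecutive _ (Nat.zero_le _) hNcN]
          ring
  calc ‖∑ n ∈ Finset.range N, F n‖ ≤ ∑ n ∈ Finset.range N, ‖F n‖ := norm_sum_le _ _
    _ ≤ 2 * M₀ * primeSum c + 2 * M₁ * (primeSum B - primeSum c) := by rw [hsplit]; linarith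

/-- **LEMMA BK½ (tapered prime term of an autocorrelation).** For a test `G` with
`tsupport G ⊆ [-b, b]`, `0 ≤ b`: `‖prime(G ⋆ G̃)‖ ≤ (S(2b) + S(b)) · ‖G‖₂²`. -/
theorem norm_weilPrimeTerm_autoCorr_le_half (hG : IsWeilTest G) (hb : 0 ≤ b)
    (hsupp : tsupport G ⊆ Icc (-b) b) :
    ‖weilPrimeTerm (autoCorr G)‖ ≤ (primeSum (2 * b) + primeSum b) * weilNorm2Sq G := by
  have hK : IsWeilTest (autoCorr G) := isWeilTest_autoCorr hG
  have hKs : tsupport (autoCorr G) ⊆ Icc (-(2 * b)) (2 * b) := tsupport_autoCorr_subset hG hsupp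
  have hN0 : 0 ≤ weilNorm2Sq G := integral_nonneg fun _ ↦ sq_nonneg _
  have h := norm_weilPrimeTerm_le_two_level hK.1.continuous hKs (by linarith)
    (fun t ↦ by simpa [autoCorr, weilNorm2Sq] using norm_weilConv_weilReflect_le hG t)
    (fun t ht ↦ norm_autoCorr_le_half hG hsupp ht)
  calc ‖weilPrimeTerm (autoCorr G)‖
      ≤ 2 * weilNorm2Sq G * primeSum b + 2 * (weilNorm2Sq G / 2) * (primeSum (2 * b) - primeSum b) := h
    _ = (primeSum (2 * b) + primeSum b) * weilNorm2Sq G := by ring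

/-! ### Appended 2026-08-24 by prove-1 gen10 (also the APPEND re-land of p375563, accepted ≈04:08Z
but never built on the hub): the real-part form consumed by THEOREM V's high-part estimate. -/

/-- **LEMMA BK½, real-part form:** `Re prime(G ⋆ G̃) ≤ (S(2b) + S(b)) · ‖G‖₂²` for a test `G`
with `tsupport G ⊆ [-b, b]`, `0 ≤ b`. -/
theorem re_weilPrimeTerm_autoCorr_le_half (hG : IsWeilTest G) (hb : 0 ≤ b)
    (hsupp : tsupport G ⊆ Icc (-b) b) :
    (weilPrimeTerm (autoCorr G)).re ≤ (primeSum (2 * b) + primeSum b) * weilNorm2Sq G :=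
  (Complex.re_le_norm _).trans (norm_weilPrimeTerm_autoCorr_le_half hG hb hsupp)

end Summit.RiemannHypothesis.RiemannHypothesis.Theorems
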